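import Summits.BirchSwinnertonDyer.BirchSwinnertonDyer.Theorems.PrintCf2RamifiedOffTYZSquareSilenceWitnesses
import Literature.NumberTheory.EllipticCurves.TianYuanZhang2017.CMPointFrobeniusValueDisplays
import Literature.NumberTheory.QuadraticFields.RamifiedPrimePairNotPrincipal
import HarnessLib

/-!
# Crux `PrintCf2.RamifiedOffTYZOfFacts` (stmt-BirchSwinnertonDyer-20509), line `offtyz-v7`, LEAD cycle 13 (cruxlead-20509 g12):
# PAIR WITNESSES — the product of the Frobenius elements of two ramified odd primes of a block `d ≡ 6 (mod 8)` squares into `Gal(ℍ′_n/H′_d)` and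
# lies OFF the Hilbert class field (`[𝔭_{q₁}][𝔭_{q₂}] ≠ 1`), from the typer's value display (p733876) and `RamifiedPrimePairNotPrincipal` (p735604)

THEOREMS ONLY (no `def`, no named fact, no `sorry`), `--supports stmt-BirchSwinnertonDyer-20509`.  Input for the transfer lemma / blockwise and
coefficient-aware silence files (`…SquareSilenceTwoPrimesEven` p732749, `…SquareSilenceWitnesses` p734271, `…SquareSilenceCoefficients` p735302): a block
without an `L_d(i)`-trivial SINGLE Frobenius element may still have an `L_d(i)`-trivial PRODUCT `φ_{q₁}φ_{q₂}` (Euler signs cancelling); this file supplies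
its two structural properties — `(φ₁φ₂)² ∈ Gal(ℍ′_n/H′_d)` ((G3): commutators of `√−d`-fixers, Cox Lemma 9.3) and `φ₁φ₂ ∉ Gal(ℍ′_n/H_d)` ((RC2) +
(F4): `toClassGroup(ρ₄(φ₁φ₂)) = [𝔭₁][𝔭₂]`, non-trivial because `𝔭₁𝔭₂` is not principal — `2 ∣ d` is a third ramified prime).  The `L_d(i)`-triviality
of the product is left to the consumer (Euler signs, (F3)).  Coverage motive (LEAD census, crux workfile `Lines/offtyz_v7_EvenTwoPrimes.md` §8): on the
k = 3 even jump-one class pair witnesses lift the reach of `…SquareSilenceCoefficients` by 25 members (of 246, `n ≤ 10⁵`); e.g. `n = 84534 = 2·3·73·193`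
(top block: `(193/73) = −1` kills both single witnesses, the pair `φ_{73}φ_{193}` is `L_n(i)`-trivial).  BSD is not proved by any of this; no class is closed.

References: [cite: TianYuanZhang2017, §3.1 (p0011 L1–L13, L60–L66), Prop. 3.2 (2) (p0010 L111–L113)]; [cite: Cox2013, §5.C Thm. 5.23, Cor. 5.25, §9.A,
Lemma 9.3]; [cite: Stevenhagen1995RedeiMatrices, §2]; tree: ty2 `CMPointFrobeniusValueDisplays` (p733876), g12 `RamifiedPrimePairNotPrincipal` (p735604).
-/

noncomputable section

open scoped Classical nonZeroDivisors

open WeierstrassCurve WeierstrassCurve.Affine Finset Literature.NumberTheory.EllipticCurves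
  Literature.NumberTheory.EllipticCurves.TianYuanZhang2017
  Literature.NumberTheory.EllipticCurves.TianYuanZhang2017.W2
  Literature.NumberTheory.QuadraticFields.RingClass Literature.NumberTheory.QuadraticFields
  Summit.BirchSwinnertonDyer.PrintCf2.MoverAssembly

set_option autoImplicit false

namespace Summit.BirchSwinnertonDyer.PrintCf2.FrobeniusPairWitness

variable {n : ℕ} (D : GenusPointData n)

/-- **The product of two Frobenius elements of a block squares into `Gal(ℍ′_n/H′_d)`**: for `φ₁, φ₂` fixing `√−d` with `φᵢ² ∈ Gal(ℍ′_n/H′_d)`,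
`(φ₁φ₂)² = φ₁²·(φ₁⁻¹φ₂φ₁φ₂⁻¹)·φ₂²` lies there too ((G3): `Gal(H′_d/K_d)` is abelian — commutators of `√−d`-fixers lie in `Gal(ℍ′_n/H′_d)`).
[cite: TianYuanZhang2017, §3.1 (p0011 L1–L13), Prop. 3.2 (1)(2)] [cite: Cox2013, Lemma 9.3] -/
theorem mul_mul_self_mem_of_cmBlockSpec {d : ℕ} {z : APoint D.H} {Φ : Finset (D.H ≃ₐ[ℚ] D.H)}
    {ΓH ΓH' : Subgroup (D.H ≃ₐ[ℚ] D.H)} {σ c : D.H ≃ₐ[ℚ] D.H} (h : D.CMBlockSpec d z Φ ΓH ΓH' σ c)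
    {φ₁ φ₂ : D.H ≃ₐ[ℚ] D.H} (h₁K : φ₁ (D.sqrtNeg d) = D.sqrtNeg d) (h₂K : φ₂ (D.sqrtNeg d) = D.sqrtNeg d)
    (h₁ : φ₁ * φ₁ ∈ ΓH') (h₂ : φ₂ * φ₂ ∈ ΓH') : (φ₁ * φ₂) * (φ₁ * φ₂) ∈ ΓH' := by
  obtain ⟨-, -, ⟨-, -, hcomm⟩, -, -, -, -, -⟩ := h
  have h₂K' : φ₂⁻¹ (D.sqrtNeg d) = D.sqrtNeg d := by
    rw [AlgEquiv.aut_inv]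
    calc φ₂.symm (D.sqrtNeg d) = φ₂.symm (φ₂ (D.sqrtNeg d)) := by rw [h₂K]
      _ = D.sqrtNeg d := φ₂.symm_apply_apply _
  have hc : φ₁⁻¹ * (φ₂⁻¹)⁻¹ * φ₁ * φ₂⁻¹ ∈ ΓH' := hcomm φ₁ φ₂⁻¹ h₁K h₂K'
  rw [inv_inv] at hc
  have e : (φ₁ * φ₂) * (φ₁ * φ₂) = (φ₁ * φ₁) * (φ₁⁻¹ * φ₂ * φ₁ * φ₂⁻¹) * (φ₂ * φ₂) := by group
  rw [e]
  exact ΓH'.mul_mem (ΓH'.mul_mem h₁ hc) h₂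

/-- **PAIR WITNESS on a block `d ≡ 6 (mod 8)`** from the value display (ty2, `FrobeniusFourValueBlockSpec`) and the conductor-`4` dictionary: for two
distinct odd primes `q₁, q₂ ∣ d` of a square-free even block `d ∣ n`, the Frobenius elements `φ₁, φ₂` ((F1)–(F3) each) have a product `e = φ₁φ₂` with
`e² ∈ Gal(ℍ′_n/H′_d)` and **`e ∉ Gal(ℍ′_n/H_d)`** — `toClassGroup(ρ₄ e) = [𝔭_{q₁}][𝔭_{q₂}] ≠ 1` because `𝔭_{q₁}𝔭_{q₂}` is not principal (the prime `2 ∣ d` is a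
third ramified prime: `RedeiReichardt.classGroupMk0_mul_ne_one_of_sq_eq_span`).  When the Euler signs of `φ₁`, `φ₂` cancel on `L_d(i)`, `e` is a
witness for the transfer lemma of `…SquareSilenceTwoPrimesEven`.
[cite: TianYuanZhang2017, Prop. 3.2 (2) (p0010 L111–L113), §3.1 (p0011 L1–L13, L60–L66)] [cite: Cox2013, §5.C Thm. 5.23, Cor. 5.25, §9.A] [cite: Stevenhagen1995RedeiMatrices, §2] -/
theorem exists_pairWitness_six (hsq : Squarefree n) {d : ℕ} (hd : d ∈ n.divisors) (hd6 : d % 8 = 6)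
    {z : APoint D.H} {Φ : Finset (D.H ≃ₐ[ℚ] D.H)} {ΓH ΓH' : Subgroup (D.H ≃ₐ[ℚ] D.H)} {σ c : D.H ≃ₐ[ℚ] D.H}
    (hCM : D.CMBlockSpec d z Φ ΓH ΓH' σ c) {ρ : D.galK d →* RingClassGroup (GenusField d) 4}
    (hRC : D.RingClassFourBlockSpec d ΓH ΓH' ρ) (hV : D.FrobeniusFourValueBlockSpec d ΓH' ρ)
    {q₁ q₂ : ℕ} (hq₁ : q₁.Prime) (hq₂ : q₂.Prime) (hne : q₁ ≠ q₂) (hq₁d : q₁ ∣ d) (hq₂d : q₂ ∣ d) (hq₁2 : q₁ ≠ 2)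
    (hq₂2 : q₂ ≠ 2) :
    ∃ φ₁ φ₂ : D.H ≃ₐ[ℚ] D.H,
      (φ₁ (D.sqrtNeg d) = D.sqrtNeg d ∧ φ₁ * φ₁ ∈ ΓH' ∧ φ₁ D.im = (jacobiSym (-1) q₁) • D.im ∧
        ∀ r : ℕ, r.Prime → r ∣ n → r ≠ q₁ → φ₁ (D.sqrtNeg r) = (jacobiSym (-(r : ℤ)) q₁) • D.sqrtNeg r) ∧
      (φ₂ (D.sqrtNeg d) = D.sqrtNeg d ∧ φ₂ * φ₂ ∈ ΓH' ∧ φ₂ D.im = (jacobiSym (-1) q₂) • D.im ∧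
        ∀ r : ℕ, r.Prime → r ∣ n → r ≠ q₂ → φ₂ (D.sqrtNeg r) = (jacobiSym (-(r : ℤ)) q₂) • D.sqrtNeg r) ∧
      (φ₁ * φ₂) * (φ₁ * φ₂) ∈ ΓH' ∧ φ₁ * φ₂ ∉ ΓH := by
  have hdsq : Squarefree d := hsq.squarefree_of_dvd (Nat.dvd_of_mem_divisors hd)
  have h2d : 2 ∣ d := by omega
  obtain ⟨ψ₁, hF2₁, hFi₁, hFr₁, P₁, hP₁0, hP₁, hval₁⟩ := hV q₁ hq₁ hq₁d hq₁2
  obtain ⟨ψ₂, hF2₂, hFi₂, hFr₂, P₂, hP₂0, hP₂, hval₂⟩ := hV q₂ hq₂ hq₂d hq₂2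
  have h₁K : (ψ₁ : D.H ≃ₐ[ℚ] D.H) (D.sqrtNeg d) = D.sqrtNeg d := (D.mem_galK_iff d _).1 ψ₁.2
  have h₂K : (ψ₂ : D.H ≃ₐ[ℚ] D.H) (D.sqrtNeg d) = D.sqrtNeg d := (D.mem_galK_iff d _).1 ψ₂.2
  refine ⟨ψ₁, ψ₂, ⟨h₁K, hF2₁, hFi₁, hFr₁⟩, ⟨h₂K, hF2₂, hFi₂, hFr₂⟩,
    mul_mul_self_mem_of_cmBlockSpec D hCM h₁K h₂K hF2₁ hF2₂, fun hmem => ?_⟩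
  -- the class of `ρ(ψ₁ψ₂)` in `Cl(𝒪_{K_d})` is `[𝔭₁][𝔭₂] ≠ 1`
  have hmem' : ((ψ₁ * ψ₂ : D.galK d) : D.H ≃ₐ[ℚ] D.H) ∈ ΓH := hmem
  have h1 : toClassGroup (GenusField d) 4 (ρ (ψ₁ * ψ₂)) = 1 := (hRC.2.2.1 (ψ₁ * ψ₂)).2 hmem'
  rw [map_mul, map_mul, hval₁, hval₂] at h1
  obtain ⟨x, hx⟩ := GenusPointData.exists_ringOfIntegers_sq_eq_neg_genusField (Nat.pos_of_ne_zero (Squarefree.ne_zero hdsq))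
  exact RedeiReichardt.classGroupMk0_mul_ne_one_of_sq_eq_span (finrank_genusField d) hdsq hx hq₁ hq₂ hne hq₁d hq₂d
    Nat.prime_two h2d (Ne.symm hq₁2) (Ne.symm hq₂2) hP₁ hP₂ hP₁0 hP₂0 h1

/-- **PAIR WITNESS from the block clauses of `CMPointRingClassFrobeniusValuePrinted`** (consumer shape): for a block `d ∈ n.divisors`, `d ≡ 6 (mod 8)`,
of a square-free `n` and distinct odd primes `q₁, q₂ ∣ d`, Frobenius elements `φ₁, φ₂` with (F1)–(F3) whose product squares into `Gal(ℍ′_n/H′_d)` and is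
NOT in `Gal(ℍ′_n/H_d)`.
[cite: TianYuanZhang2017, Prop. 3.2 (2) (p0010 L111–L113)] [cite: Cox2013, §5.C Thm. 5.23, Cor. 5.25, §9.A] [cite: Stevenhagen1995RedeiMatrices, §2] -/
theorem exists_pairWitness_of_clauses (hsq : Squarefree n)
    {z : ℕ → APoint D.H} {Φ : ℕ → Finset (D.H ≃ₐ[ℚ] D.H)} {ΓH ΓH' : ℕ → Subgroup (D.H ≃ₐ[ℚ] D.H)}
    {σ θ : ℕ → (D.H ≃ₐ[ℚ] D.H)} {c : D.H ≃ₐ[ℚ] D.H}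
    {ρ₂ : (d : ℕ) → (D.galK d →* RingClassGroup (GenusField d) 2)}
    {ρ₄ : (d : ℕ) → (D.galK d →* RingClassGroup (GenusField d) 4)}
    (hb : ∀ d ∈ n.divisors,
      ((d % 8 = 5 ∨ d % 8 = 6) → D.CMBlockSpec d (z d) (Φ d) (ΓH d) (ΓH' d) (σ d) c) ∧
      (d % 8 = 6 → D.ThetaBlockSpec d (z d) (ΓH d) (ΓH' d) (σ d) (θ d)) ∧
      (d % 8 = 7 → D.SevenBlockSpec d) ∧
      (d % 8 = 5 → D.RingClassTwoBlockSpec d (ΓH d) (ΓH' d) (ρ₂ d)) ∧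
      (d % 8 = 6 → D.RingClassFourBlockSpec d (ΓH d) (ΓH' d) (ρ₄ d)) ∧
      (d % 8 = 5 → D.FrobeniusTwoBlockSpec d (ΓH' d)) ∧
      (d % 8 = 6 → D.FrobeniusFourBlockSpec d (ΓH' d)) ∧
      (d % 8 = 6 → D.FrobeniusFourValueBlockSpec d (ΓH' d) (ρ₄ d)))
    {d : ℕ} (hd : d ∈ n.divisors) (hd6 : d % 8 = 6) {q₁ q₂ : ℕ} (hq₁ : q₁.Prime) (hq₂ : q₂.Prime) (hne : q₁ ≠ q₂)
    (hq₁d : q₁ ∣ d) (hq₂d : q₂ ∣ d) (hq₁2 : q₁ ≠ 2) (hq₂2 : q₂ ≠ 2) :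
    ∃ φ₁ φ₂ : D.H ≃ₐ[ℚ] D.H,
      (φ₁ (D.sqrtNeg d) = D.sqrtNeg d ∧ φ₁ * φ₁ ∈ ΓH' d ∧ φ₁ D.im = (jacobiSym (-1) q₁) • D.im ∧
        ∀ r : ℕ, r.Prime → r ∣ n → r ≠ q₁ → φ₁ (D.sqrtNeg r) = (jacobiSym (-(r : ℤ)) q₁) • D.sqrtNeg r) ∧
      (φ₂ (D.sqrtNeg d) = D.sqrtNeg d ∧ φ₂ * φ₂ ∈ ΓH' d ∧ φ₂ D.im = (jacobiSym (-1) q₂) • D.im ∧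
        ∀ r : ℕ, r.Prime → r ∣ n → r ≠ q₂ → φ₂ (D.sqrtNeg r) = (jacobiSym (-(r : ℤ)) q₂) • D.sqrtNeg r) ∧
      (φ₁ * φ₂) * (φ₁ * φ₂) ∈ ΓH' d ∧ φ₁ * φ₂ ∉ ΓH d :=
  exists_pairWitness_six D hsq hd hd6 ((hb d hd).1 (Or.inr hd6)) ((hb d hd).2.2.2.2.1 hd6) ((hb d hd).2.2.2.2.2.2.2 hd6)
    hq₁ hq₂ hne hq₁d hq₂d hq₁2 hq₂2

end Summit.BirchSwinnertonDyer.PrintCf2.FrobeniusPairWitness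

end
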